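import Summits.CriticalPhenomena.PercolationContinuityZ3.Theses.PercSieveRigidity
import Literature.Probability.LatticeModels.ProdBernoulliCoupling
import Literature.Probability.Percolation.SubgraphMonotonicity
import Literature.Probability.Percolation.CriticalContinuityProofs

/-!
# Birth skeleton (BC3) for the crux `StrictPlugSieve` (stmt-CriticalPhenomena-7690)

Route `route-CriticalPhenomena-PercSieveRigidity` (sub-problem `PercolationContinuityZ3`), crux decl
`Summit.CriticalPhenomena.PercolationContinuityZ3.Theses.PercSieveRigidity.StrictPlugSieve` (rank 2):

  `∀ L ≥ 1, ∀ (i : Fin 3) (c : ℤ³), p_c(ℤ³, 0) < p_c(ℤ³ ∖ D_(L,i,c), 0)`,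

`D_(L,i,c) = {s(x, x + e_i) : L ∣ x_j − c_j ∀ j}` the single-edge periodic sieve, `ℤ³ ∖ D` the graph
`(zdGraph 3).deleteEdges D` — Aizenman–Grimmett strict monotonicity for the periodic pair `ℤ³ ∖ D ⊂ ℤ³`
(Grimmett 1999 §3.3 Thm (3.16), Examples B–C p. 66; repair of the method: Balister–Bollobás–Riordan,
arXiv:1402.0834), a PORT, not a citation (grounder g13-41, refuter rreview a895813f).

THE LINE (Aizenman–Grimmett in the Martineau–Severo §4 shape, the shape the tree already PROVES for
quotients: `Literature.Probability.Percolation.OrbitQuotient.criticalProb_lt_of_props` assembles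
Props 4.1/4.2, `EnhProp42.exists_lt_criticalProb_enhEvent_ge` is Prop 4.2 from the abstract
differential-inequality / line-segment file `EnhancementAGLine.lean`). Put the deleted sieve edges back
with their OWN density `s`: the AG two-parameter model `ℙ_{p,s}` on bond configurations of `ℤ³`
(independent edges, density `p` on `E(ℤ³) ∖ D`, `s` on `D`, `0` off `E(ℤ³)`; `agMeasure`, an instance of
the tree's inhomogeneous product measure `prodBernoulli`) and `Θ(p, s) := ℙ_{p,s}(|C(0)| = ∞)`
(`agTheta`). `Θ(·, 0)` is percolation on the sieved lattice `H := ℤ³ ∖ D`, `Θ(p, p)` is percolation on `ℤ³`.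

* STUB A `stub_sieveEnhancementPercolates` (L/XL — LOAD-BEARING, the AG heart; Prop 4.2 analogue):
  if `p_c(H, 0) < 1` then for every `ε ∈ (0, p_c(H, 0))` and every `s > 0` there is
  `p ∈ [ε, p_c(H, 0))` with `Θ(p, s) > 0` — the sieve edges are an ESSENTIAL enhancement of `H`:
  re-inserting them at any positive density makes the model percolate strictly below `p_c(H)`.
  Foreseen proof = `EnhProp42.exists_lt_criticalProb_enhEvent_ge` re-run with mark coordinates = sieve
  edges: (A1) a deterministic local-modification lemma in the format `AGLine.LocMod` (an `H`-edge `e`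
  pivotal for `{0 ↔ distance n}` ⟹ after re-wiring the `H`-edges and CLOSING sieve edges inside a window
  of radius `O(L)` around `e`, some sieve edge of the window is pivotal — every vertex is within
  sup-distance `L` of a sieve edge; this is the Balister–Bollobás–Riordan-sensitive step), (A2) the
  tree's `AGLine.sum_piv_inl_le` / `AGLine.theta_line_mono` / `AGLine.theta_mono_s` on the finite-volume
  polynomials and `θ_H(0, p₀) > 0` for a `p₀ ∈ (p_c(H), 1)` on the segment, (A3) continuity from above
  (`theta_pos_of_farEvent` pattern) to pass to `|C(0)| = ∞`. For `L = 1` (`H` = disjoint planes) the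
  same argument runs on the connected two-layer system, or reduce to `L = 2`.
* STUB B `stub_twoParameterSandwich` (M, TRUE — provable now): for `s ≤ p`,
  `θ_H(0, p) ≤ Θ(p, s) ≤ θ_{ℤ³}(0, p)` (Prop 4.1 analogue, here a plain monotone coupling): the three
  laws are `prodBernoulli` of the pointwise ordered parameter vectors `𝟙_{E∖D}·p ≤ agParam p s ≤ 𝟙_E·p`
  (`prodBernoulli_indicator_holds`, `SimpleGraph.edgeSet_deleteEdges`, `D ⊆ E(ℤ³)` by `zdGraph_adj_iff`),
  and `{|C(0)| = ∞}` is increasing and measurable (`percolatesAt_mono`, `measurableSet_percolatesAt_holds`),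
  so `prodBernoulli_real_mono_of_isUpperSet` applies twice.
* STUB C `stub_planeComparison` (M, TRUE — provable now): `p_c(H, 0) ≤ p_c(ℤ², 0)`: the coordinate plane
  `{x_i = 0}` through the origin carries no sieve edge, so `f := Fin.insertNth i 0 : ℤ² → ℤ³` is an
  injective graph map with `H.comap f = zdGraph 2` and `f 0 = 0`; `theta_comap_le` +
  `criticalProb_le_of_theta_le`. With `criticalProb_zd_lt_one` it supplies the hypothesis `p_c(H, 0) < 1`
  of STUB A.

Composition (kernel-checked, no `sorry`): `StrictPlugSieve_of : stub_A → stub_B → stub_C → StrictPlugSieve`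
(hypotheses typed by the name-keyed aliases `__Registered.stub_*`, device of
`Cruxes/BGNOffTheFloor/Lines/birth.lean` / `Cruxes/UniformSteering/Lines/birth.lean`). Proof = Martineau–Severo
§4 verbatim: `p_c(ℤ³) ≤ p_c(H)` from the sandwich at `s = p` (`criticalProb_le_of_theta_le`); with
`ε = s := p_c(ℤ³)/2` (`criticalProb_zd_pos`) STUB A gives `p ∈ [ε, p_c(H))` with `Θ(p, s) > 0`; as
`s ≤ p`, the upper sandwich gives `θ_{ℤ³}(0, p) > 0`, so `p_c(ℤ³) ≤ p < p_c(H)`.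

ALL THREE STUBS ARE LOAD-BEARING (A: the strict gap; B: both halves — lower for `ε < p_c(H)`, upper to
transfer positivity to `ℤ³`; C: the hypothesis of A). None is the crux or the conjunct in costume: A is a
statement about the two-parameter model strictly below `p_c(H)` for SMALL `s` (the crux is its single
consequence at `s = p`), B and C are coupling inequalities (BC3 probes `stub → StrictPlugSieve`,
`stub → PercolationContinuityZ3` by `first | exact? | simpa | aesop` fail, planner folder `bc/probe_*.lean`).

DISPROOF USED: none exists for this crux (`ledger crux ls stmt-CriticalPhenomena-7690`: no workfiles, no
`Disproof.lean`, no landed `Theorems/StrictPlugSieve/Negative/*`, 2026-08-17). Negatives index of the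
summit (11 refuted statements): nothing on strict inequalities of critical points, enhancements or
sieves. Degenerate instances checked: `L = 0` never occurs (`1 ≤ L` everywhere); `p_c(H, 0)` is junk-free
(`criticalProb ∈ [0, 1]`, `= 1` only if `θ_H ≡ 0`, excluded by STUB C); the `unitInterval` witnesses of the
glue are built from `0 < p_c(ℤ³) ≤ 1` (`criticalProb_zd_pos`, `criticalProb_mem_Icc`).
-/

noncomputable section

namespace Summit.CriticalPhenomena.PercolationContinuityZ3.Cruxes.StrictPlugSieve.Birth

open MeasureTheory Literature.Probability.Percolation Literature.Probability.LatticeModels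
open Summit.CriticalPhenomena.PercolationContinuityZ3.Theses.PercSieveRigidity (StrictPlugSieve)

/-! ## Objects of the line -/

/-- The single-edge periodic sieve `D_(L,i,c) = {s(x, x + e_i) : L ∣ x_j − c_j for all j}` — VERBATIM the
set-builder of the crux. -/
def sieve (L : ℕ) (i : Fin 3) (c : Site 3) : Set (Sym2 (Site 3)) :=
  {e | ∃ x : Site 3, (∀ j, (L : ℤ) ∣ x j - c j) ∧ e = s(x, x + Pi.single i 1)}

/-- The sieved lattice `H = ℤ³ ∖ D_(L,i,c)` (verbatim the crux's `deleteEdges`). -/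
def sievedGraph (L : ℕ) (i : Fin 3) (c : Site 3) : SimpleGraph (Site 3) :=
  (zdGraph 3).deleteEdges (sieve L i c)

open scoped Classical in
/-- The Aizenman–Grimmett two-parameter densities: `p` on the edges of `ℤ³` off the sieve, `s` on the
sieve edges, `0` on non-edges of `ℤ³`. -/
def agParam (L : ℕ) (i : Fin 3) (c : Site 3) (p s : unitInterval) : Sym2 (Site 3) → unitInterval :=
  fun e => if e ∈ sieve L i c then s else if e ∈ (zdGraph 3).edgeSet then p else 0

/-- `ℙ_{p,s}`: independent edges with the two-parameter densities `agParam` (the tree's inhomogeneous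
product Bernoulli measure `prodBernoulli`). `ℙ_{p,0}` is bond percolation on `ℤ³ ∖ D`, `ℙ_{p,p}` is bond
percolation on `ℤ³` (`prodBernoulli_indicator_holds`). -/
def agMeasure (L : ℕ) (i : Fin 3) (c : Site 3) (p s : unitInterval) : Measure (BondConfig (Site 3)) :=
  prodBernoulli (agParam L i c p s)

/-- `Θ(p, s) := ℙ_{p,s}(|C(0)| = ∞)`, the two-parameter percolation probability at the origin. -/
def agTheta (L : ℕ) (i : Fin 3) (c : Site 3) (p s : unitInterval) : ℝ :=
  (agMeasure L i c p s).real (percolatesAt (0 : Site 3))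

/-- `p_c = p_c(ℤ³, 0)` (bond). -/
def pc3 : ℝ := criticalProb (zdGraph 3) (0 : Site 3)

/-- `p_c(H, 0)`, the critical point of the sieved lattice at the origin. -/
def pcSieved (L : ℕ) (i : Fin 3) (c : Site 3) : ℝ := criticalProb (sievedGraph L i c) (0 : Site 3)

theorem pc3_pos : 0 < pc3 := criticalProb_zd_pos 3 (by norm_num)

theorem pc3_le_one : pc3 ≤ 1 := (criticalProb_mem_Icc (zdGraph 3) (0 : Site 3)).2

/-- The crux, literally, in the line's vocabulary. -/
theorem strictPlugSieve_iff :
    StrictPlugSieve ↔ ∀ L : ℕ, 1 ≤ L → ∀ (i : Fin 3) (c : Site 3), pc3 < pcSieved L i c :=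
  Iff.rfl

/-! ## The three stub statements -/

/-- STUB A statement (Prop 4.2 analogue, the AG heart): the re-inserted sieve edges are an essential
enhancement of `H = ℤ³ ∖ D` — for every positive sieve density `s` the two-parameter model percolates at
some `p` strictly below `p_c(H, 0)` (and as close to it as wanted). -/
def SieveEnhancementPercolates : Prop :=
  ∀ L : ℕ, 1 ≤ L → ∀ (i : Fin 3) (c : Site 3), pcSieved L i c < 1 →
    ∀ ε : ℝ, 0 < ε → ε < pcSieved L i c → ∀ s : unitInterval, 0 < (s : ℝ) →
      ∃ p : unitInterval, ε ≤ (p : ℝ) ∧ (p : ℝ) < pcSieved L i c ∧ 0 < agTheta L i c p s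

/-- STUB B statement (Prop 4.1 analogue, monotone coupling): for `s ≤ p` the two-parameter model sits
between percolation on the sieved lattice and percolation on `ℤ³`. -/
def TwoParameterSandwich : Prop :=
  ∀ L : ℕ, 1 ≤ L → ∀ (i : Fin 3) (c : Site 3) (p s : unitInterval), s ≤ p →
    theta (sievedGraph L i c) (0 : Site 3) p ≤ agTheta L i c p s ∧
      agTheta L i c p s ≤ theta (zdGraph 3) (0 : Site 3) p

/-- STUB C statement (the sieved lattice still contains the square lattice `{x_i = 0}` through the
origin): `p_c(H, 0) ≤ p_c(ℤ², 0)`. -/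
def PlaneComparison : Prop :=
  ∀ L : ℕ, 1 ≤ L → ∀ (i : Fin 3) (c : Site 3), pcSieved L i c ≤ criticalProb (zdGraph 2) (0 : Site 2)

/-! ## Registered stubs -/

/-- **STUB A `sieveEnhancementPercolates`** (L/XL, OPEN — LOAD-BEARING). Aizenman–Grimmett 1991 /
Grimmett 1999 Thm (3.16) for the enhancement "open the sieve edge" of `ℤ³ ∖ D_(L,i,c)`, in the
finite-energy / line-segment form of Martineau–Severo 2019 §6. Template: `EnhProp42.exists_lt_criticalProb_enhEvent_ge`
(mark coordinates ↦ sieve edges; the local modification only CLOSES sieve edges, so the weight comparison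
`AGLine.gW_le_of_modification` with `s ≤ 1/2` applies as is; window radius `O(L)`, degree bound `6`).
Why it might fail: the deterministic local-modification lemma (A1) is exactly where AG91's printed path
lemma is false (BBR14, arXiv:1402.0834 §2); it must be redone for the sieve geometry, including the
windows meeting the origin and the target sphere, and the disconnected case `L = 1`.
Sources: AizenmanGrimmett1991, Grimmett1999 §3.3, MartineauSevero2019 §6, arXiv:1402.0834. -/
theorem stub_sieveEnhancementPercolates : SieveEnhancementPercolates := by
  sorry

/-- **STUB B `twoParameterSandwich`** (M, TRUE): `θ_{ℤ³∖D}(0,p) ≤ Θ(p,s) ≤ θ_{ℤ³}(0,p)` for `s ≤ p`.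
Proof sketch: `bondPercolation G p = prodBernoulli (fun e => if e ∈ G.edgeSet then p else 0)`
(`prodBernoulli_indicator_holds`); `(sievedGraph L i c).edgeSet = E(ℤ³) ∖ D` (`SimpleGraph.edgeSet_deleteEdges`)
and `D ⊆ E(ℤ³)` (`zdGraph_adj_iff`), so the three parameter vectors are pointwise ordered; `percolatesAt 0`
is an upper set (`percolatesAt_mono`) and measurable (`measurableSet_percolatesAt_holds`); conclude with
`prodBernoulli_real_mono_of_isUpperSet` twice. -/
theorem stub_twoParameterSandwich : TwoParameterSandwich := by
  sorry

/-- **STUB C `planeComparison`** (M, TRUE): `p_c(ℤ³ ∖ D, 0) ≤ p_c(ℤ², 0)`.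
Proof sketch: `f : Site 2 → Site 3`, `f y := Fin.insertNth i 0 y` is injective with `f 0 = 0`, and
`(sievedGraph L i c).comap f = zdGraph 2` (`SimpleGraph.ext` with `zdGraph_adj_iff`: plane edges change a
coordinate `≠ i`, sieve edges change the coordinate `i`); then `theta_comap_le` gives
`θ_{ℤ²}(0,p) ≤ θ_H(0,p)` for all `p`, and `criticalProb_le_of_theta_le`. -/
theorem stub_planeComparison : PlaneComparison := by
  sorry

/-! ### Name-keyed aliases of the stub statements
`__Registered.stub_X` is statement `X` under the registered stub's short name, so that the native skeleton
audit (`#h21_check_skeleton`: hypotheses admissible iff registered obligations / declared stubs BY NAME)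
accepts `StrictPlugSieve_of : __Registered.stub_… → … → StrictPlugSieve` (device of
`Cruxes/BGNOffTheFloor/Lines/birth.lean`; the `@[stub]` attribute is gate-reserved). -/
namespace __Registered

/-- Alias of `SieveEnhancementPercolates` keyed by the registered stub name. -/
abbrev stub_sieveEnhancementPercolates : Prop := SieveEnhancementPercolates
/-- Alias of `TwoParameterSandwich` keyed by the registered stub name. -/
abbrev stub_twoParameterSandwich : Prop := TwoParameterSandwich
/-- Alias of `PlaneComparison` keyed by the registered stub name. -/
abbrev stub_planeComparison : Prop := PlaneComparison

end __Registered

/-! ## Proved plumbing -/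

/-- `θ_{ℤ³}(0, p) > 0` puts `p` above `p_c(ℤ³)` (order theory on the `sInf` defining `criticalProb`). -/
theorem pc3_le_of_theta_pos (p : unitInterval) (h : 0 < theta (zdGraph 3) (0 : Site 3) p) :
    pc3 ≤ (p : ℝ) := by
  unfold pc3 criticalProb
  refine csInf_le ⟨0, ?_⟩ (Or.inl ⟨p.2, by simpa using h⟩)
  rintro q (⟨hq, -⟩ | hq)
  · exact hq.1
  · rw [Set.mem_singleton_iff] at hq
    rw [hq]; exact zero_le_one

/-- The sandwich at `s = p` gives the (weak) monotonicity `p_c(ℤ³, 0) ≤ p_c(ℤ³ ∖ D, 0)`. -/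
theorem pc3_le_pcSieved (hB : TwoParameterSandwich) {L : ℕ} (hL : 1 ≤ L) (i : Fin 3) (c : Site 3) :
    pc3 ≤ pcSieved L i c :=
  criticalProb_le_of_theta_le (zdGraph 3) (0 : Site 3) (sievedGraph L i c) (0 : Site 3) fun p =>
    (hB L hL i c p p le_rfl).1.trans (hB L hL i c p p le_rfl).2

/-! ## The composition, by name -/

/-- **`StrictPlugSieve_of`**: the three registered stubs imply the crux
`Summit.CriticalPhenomena.PercolationContinuityZ3.Theses.PercSieveRigidity.StrictPlugSieve`
(kernel-checked; no `sorry` outside the stubs). Martineau–Severo §4: `ε = s := p_c(ℤ³)/2`. -/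
theorem StrictPlugSieve_of (hA : __Registered.stub_sieveEnhancementPercolates)
    (hB : __Registered.stub_twoParameterSandwich) (hC : __Registered.stub_planeComparison) :
    Summit.CriticalPhenomena.PercolationContinuityZ3.Theses.PercSieveRigidity.StrictPlugSieve := by
  rw [strictPlugSieve_iff]
  intro L hL i c
  -- `p_c(H) < 1` (STUB C + `p_c(ℤ²) < 1`) and `0 < p_c(ℤ³) ≤ p_c(H)` (STUB B)
  have hC1 : pcSieved L i c < 1 := (hC L hL i c).trans_lt (criticalProb_zd_lt_one le_rfl)
  have h3H : pc3 ≤ pcSieved L i c := pc3_le_pcSieved hB hL i c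
  have hε0 : 0 < pc3 / 2 := half_pos pc3_pos
  have hεH : pc3 / 2 < pcSieved L i c := by linarith [pc3_pos]
  -- the sieve density `s := p_c(ℤ³)/2`
  set s : unitInterval := ⟨pc3 / 2, hε0.le, (half_le_self pc3_pos.le).trans pc3_le_one⟩ with hs
  have hs0 : 0 < (s : ℝ) := hε0
  -- STUB A: a percolating point of the two-parameter model strictly below `p_c(H)`, with `p ≥ s`
  obtain ⟨p, hεp, hpH, hpos⟩ := hA L hL i c hC1 (pc3 / 2) hε0 hεH s hs0
  have hsp : s ≤ p := by
    show (s : ℝ) ≤ (p : ℝ)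
    exact hεp
  -- STUB B (upper half): `ℤ³` percolates at `p`, hence `p_c(ℤ³) ≤ p < p_c(H)`
  have hθ : 0 < theta (zdGraph 3) (0 : Site 3) p := hpos.trans_le (hB L hL i c p s hsp).2
  exact (pc3_le_of_theta_pos p hθ).trans_lt hpH

/-- Wiring check: the registered stubs feed `StrictPlugSieve_of` as stated. -/
example : Summit.CriticalPhenomena.PercolationContinuityZ3.Theses.PercSieveRigidity.StrictPlugSieve :=
  StrictPlugSieve_of stub_sieveEnhancementPercolates stub_twoParameterSandwich stub_planeComparison

end Summit.CriticalPhenomena.PercolationContinuityZ3.Cruxes.StrictPlugSieve.Birth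

end
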